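import Summits.QuantumFields.BalabanUV.T4Continuum.Support.RegionGaugeTwoZoneTransfer

/-!
# T⁴ programme, spine node NE2 (U1a), sub-row Δ1 «NE2⁰-Dirichlet» — THE LATTICE GAFFNEY IDENTITY OF A REGION (any union of unit blocks):
# `‖curl_Ω A‖² + ‖∂_Ω*A‖² + (exterior flux)² = Σ_ν ‖∇_ν ιA‖²`

NE2 formalisation swarm `b2b-balaban-t4-ne2-formalise-*`, leaf 07 (gen 6), supplier item «Δ1-COERC» (owner R23 (a) / R25 / R26), the kernel form
of the mechanism (L2) of the census `t4/T4-EST-NE2-D1-COERC.md` §5 and the first brick [G] of its route (r5) (§10, v1.1).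

WHAT IS PRINTED ([Balaban1984PropagatorsI] (1.21) p.21): «⟨∂A, ∂A⟩ = ½ Σ_{x∈T_η,μ,ν} η^d|F_{μν}(x)|² = … = Σ_μ ⟨A_μ, ΔA_μ⟩ − ⟨∂*A, ∂*A⟩» — on
the TORUS the Wilson (curl) energy plus the divergence energy is the rough (gradient) energy: `Δ = ∂*∂ + ∂∂*` componentwise (tree:
`B5Action121.curl_adjoint_curl`, `Lap = Σ_ν ∇_νᴴ∇_ν`).

WHAT THIS FILE PROVES (0 sorry), for the [B9]-faithful `U = 1` region objects of gen 5 (`Support/RegionGaugeFixedVector`: STAR bonds of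
`Ω = blockReg S`, `curlR` = torus curl of the zero-extension `ιA`, `gradRᴴ` = divergence read on the sites of `Ω`) and ANY decidable `S`:
 * §1 `nsq_curl_eq_two_mul` — (1.21) in `nsq` form on the torus: `‖Curl B‖² = 2·(Re⟨B, ΔB⟩ − ‖∂ᴴB‖²)`.
 * §2 **`gaffney_region`**: `‖curlR A‖² + ‖gradRᴴ A‖² + extFlux A = Σ_ν ‖∇_ν ιA‖²`, where
   **`extFlux A := Σ_{x ∉ Ω} ‖(∂ᴴ ιA)(x)‖²`** is the EXTERIOR FLUX of the zero-extension (the torus divergence at the sites OUTSIDE `Ω`, fed only by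
   the normal star bonds crossing `∂Ω`); hence **`curl_add_div_le_gradEnergy`** (`‖curlR A‖² + ‖gradRᴴA‖² ≤ Σ_ν‖∇_ν ιA‖²`) and
   **`gradEnergy_sub_extFlux_eq`**.
READING (census (L2), owner R25 (a)): the faithful region form `‖curl A‖² + ‖R·∂_Ω*A‖² + a n^d‖QA‖²` is bounded by the zero-extension gradient
energy MINUS the exterior flux; the flux is exactly what a zero-extension gradient-form bound (W2 with a level-uniform constant) would have to
control and cannot (the slab mode: curl 0, region divergence 0, flux `≍ n‖A‖²/width`).  On a corner-free region the flux terms are the normal-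
direction jumps of the normal components, so the identity is the lattice «electric Gaffney inequality» `‖∇_int A‖² ≤ ‖curl A‖² + ‖div_Ω A‖²`
(interior differences; not spelled out here).

HONEST FRAMING (T4-DAG p. 1).  Model level (`U = 1`, one region, finite torus); [folklore] finite summation over landed modules; an IDENTITY,
no estimate of the located open inequality `SliceCoercive` (G-ne2leaf07g5-1, OPEN); NOT [B9] (3.23)–(3.27) as printed; NE2 (U1a) NOT proved;
spine 0/9 unchanged; NOT infinite volume / mass gap / Clay / summit progress.  HONEST DEPENDENCY: continuum YM on T⁴ ⇐ BetaPertH ∧ nine spine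
estimates (0/9 proved); BetaPertH ⇐ (D1) ∧ (D4) ∧ CAP+tail; G-an2-4 gates asym, D1 and NE2/3/4.  No `sorry`.
-/

noncomputable section

open scoped BigOperators ComplexConjugate Matrix Matrix.Norms.L2Operator
open Finset

namespace Summit.QuantumFields.BalabanUV.T4Continuum.RegionGaffneyIdentity

open Literature.MathematicalPhysics.QuantumFieldTheory.Balaban1983to89.B5Prop11Plancherel (Tor fine fdiff)
open Literature.MathematicalPhysics.QuantumFieldTheory.Balaban1983to89.B5Prop11Lower (nsq nsq_nonneg Lap star_dotProduct_self)
open Literature.MathematicalPhysics.QuantumFieldTheory.Balaban1983to89.B5Action121 (GradOp CurlOp curl_adjoint_curl Lap_eq_LapV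
  star_mulVec_dotProduct)
open Summit.QuantumFields.BalabanUV.T4Continuum
open Summit.QuantumFields.BalabanUV.T4Continuum.SubtypeCompression (ext)
open Summit.QuantumFields.BalabanUV.T4Continuum.RegionGaugeSlice (form_gram)
open Summit.QuantumFields.BalabanUV.T4Continuum.RegionGaugeFixedVector (starReg curlR gradR)
open Summit.QuantumFields.BalabanUV.T4Continuum.RegionGaugeSliceTorus (nsq_curlR_mulVec gradR_conjTranspose_mulVec)
open Summit.QuantumFields.BalabanUV.T4Continuum.RegionGaugeTwoZoneTransfer (re_form_Lap_eq)
open Summit.QuantumFields.BalabanUV.Beta.GAN24.DirichletBoxTrace (blockReg)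

variable {d : ℕ}

section Torus

variable (n : ℕ) [NeZero n] (M : Fin d → ℕ) [hM : ∀ μ, NeZero (M μ)]

/-- **(1.21) in `nsq` form**: `‖Curl B‖² = 2·(Re⟨B, ΔB⟩ − ‖∂ᴴB‖²)` on the torus (`CurlᴴCurl = 2(Δ − ∂∂ᴴ)`).
[cite: Balaban1984PropagatorsI, (1.21) p.21] [folklore] -/
theorem nsq_curl_eq_two_mul (B : Tor (fine n M) × Fin d → ℂ) :
    nsq (CurlOp (fine n M) (n : ℂ) *ᵥ B)
      = 2 * ((star B ⬝ᵥ (Lap n M *ᵥ B)).re - nsq ((GradOp (fine n M) (n : ℂ))ᴴ *ᵥ B)) := by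
  have h1 : ((nsq (CurlOp (fine n M) (n : ℂ) *ᵥ B) : ℝ) : ℂ)
      = (2 : ℂ) • (star B ⬝ᵥ (Lap n M *ᵥ B) - star B ⬝ᵥ ((GradOp (fine n M) (n : ℂ) * (GradOp (fine n M) (n : ℂ))ᴴ) *ᵥ B)) := by
    rw [← form_gram (CurlOp (fine n M) (n : ℂ)) B, curl_adjoint_curl, ← Lap_eq_LapV, Matrix.smul_mulVec, dotProduct_smul,
      Matrix.sub_mulVec, dotProduct_sub]
  have h2 : star B ⬝ᵥ ((GradOp (fine n M) (n : ℂ) * (GradOp (fine n M) (n : ℂ))ᴴ) *ᵥ B)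
      = ((nsq ((GradOp (fine n M) (n : ℂ))ᴴ *ᵥ B) : ℝ) : ℂ) := by
    rw [← Matrix.mulVec_mulVec, ← star_dotProduct_self, star_mulVec_dotProduct, Matrix.conjTranspose_conjTranspose]
  rw [h2] at h1
  have := congrArg Complex.re h1
  simp only [Complex.ofReal_re, smul_eq_mul, Complex.mul_re, Complex.sub_re, Complex.sub_im, Complex.ofReal_im] at this
  norm_num at this
  linarith

/-- **THE TORUS WEITZENBÖCK IDENTITY IN ENERGY FORM**: `½‖Curl B‖² + ‖∂ᴴB‖² = Σ_ν ‖∇_ν B‖²`.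
[cite: Balaban1984PropagatorsI, (1.21) p.21] [folklore] -/
theorem half_nsq_curl_add_nsq_div (B : Tor (fine n M) × Fin d → ℂ) :
    1 / 2 * nsq (CurlOp (fine n M) (n : ℂ) *ᵥ B) + nsq ((GradOp (fine n M) (n : ℂ))ᴴ *ᵥ B)
      = ∑ ν, nsq (fdiff (fine n M) (n : ℂ) ν *ᵥ B) := by
  rw [← re_form_Lap_eq, nsq_curl_eq_two_mul]; ring

end Torus

/-! ## §2 The identity on a region: curl² + div_Ω² + exterior flux = gradient energy of the zero-extension -/

section Region

variable (n : ℕ) [NeZero n] (M : Fin d → ℕ) [hM : ∀ μ, NeZero (M μ)] (S : Tor M → Prop) [DecidablePred S]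

/-- **THE EXTERIOR FLUX** of a field on the star bonds of `Ω`: the torus divergence of its zero-extension summed over the sites OUTSIDE `Ω`
(fed only by the normal star bonds crossing `∂Ω`). [folklore] -/
def extFlux (A : {b // starReg n M S b} → ℂ) : ℝ :=
  ∑ x : {x // ¬ blockReg n M S x}, ‖((GradOp (fine n M) (n : ℂ))ᴴ *ᵥ ext (starReg n M S) A) x‖ ^ 2

/-- the exterior flux is nonnegative. [folklore] -/
theorem extFlux_nonneg (A : {b // starReg n M S b} → ℂ) : 0 ≤ extFlux n M S A :=
  Finset.sum_nonneg fun _ _ => sq_nonneg _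

/-- the torus divergence energy of the zero-extension splits into the region divergence and the exterior flux. [folklore] -/
theorem nsq_div_ext_eq (A : {b // starReg n M S b} → ℂ) :
    nsq ((GradOp (fine n M) (n : ℂ))ᴴ *ᵥ ext (starReg n M S) A) = nsq ((gradR n M S)ᴴ *ᵥ A) + extFlux n M S A := by
  rw [gradR_conjTranspose_mulVec]
  unfold nsq extFlux
  exact (Fintype.sum_subtype_add_sum_subtype (blockReg n M S)
    (fun x => ‖((GradOp (fine n M) (n : ℂ))ᴴ *ᵥ ext (starReg n M S) A) x‖ ^ 2)).symm

/-- **THE LATTICE GAFFNEY IDENTITY OF A REGION**: `‖curlR A‖² + ‖gradRᴴ A‖² + extFlux A = Σ_ν ‖∇_ν ιA‖²` — for EVERY union of unit blocks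
(no corner condition: it is (1.21) for the zero-extension, with the divergence energy split at `∂Ω`).
[cite: Balaban1984PropagatorsI, (1.21) p.21 (shape)] [folklore] -/
theorem gaffney_region (A : {b // starReg n M S b} → ℂ) :
    nsq (curlR n M S *ᵥ A) + nsq ((gradR n M S)ᴴ *ᵥ A) + extFlux n M S A
      = ∑ ν, nsq (fdiff (fine n M) (n : ℂ) ν *ᵥ ext (starReg n M S) A) := by
  rw [nsq_curlR_mulVec, add_assoc, ← nsq_div_ext_eq, half_nsq_curl_add_nsq_div]

/-- **hence the faithful curl and divergence energies are bounded by the gradient energy of the zero-extension** (what they MISS is exactly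
the exterior flux). [folklore] -/
theorem curl_add_div_le_gradEnergy (A : {b // starReg n M S b} → ℂ) :
    nsq (curlR n M S *ᵥ A) + nsq ((gradR n M S)ᴴ *ᵥ A) ≤ ∑ ν, nsq (fdiff (fine n M) (n : ℂ) ν *ᵥ ext (starReg n M S) A) := by
  rw [← gaffney_region]; exact le_add_of_nonneg_right (extFlux_nonneg n M S A)

/-- … and conversely the gradient energy of the zero-extension exceeds them by exactly the exterior flux. [folklore] -/
theorem gradEnergy_sub_extFlux_eq (A : {b // starReg n M S b} → ℂ) :
    (∑ ν, nsq (fdiff (fine n M) (n : ℂ) ν *ᵥ ext (starReg n M S) A)) - extFlux n M S A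
      = nsq (curlR n M S *ᵥ A) + nsq ((gradR n M S)ᴴ *ᵥ A) := by
  rw [← gaffney_region]; ring

end Region

end Summit.QuantumFields.BalabanUV.T4Continuum.RegionGaffneyIdentity

end
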